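import Summits.QuantumFields.YangMills.Theorems.UnitScaleTiltFluctuationComparisonRegPrRepAtHeightsSocket
import Summits.QuantumFields.YangMills.Theorems.UnitScaleTiltFluctuationComparisonRegPrSmallFieldEnvelopeWithin
import Summits.QuantumFields.YangMills.Theorems.UnitScaleTiltFluctuationComparisonRegPrPrintChi
import HarnessLib

/-!
# `UnitScaleTiltFluctuationComparisonRegPrRepAtHeightsSocketOn` — THE (41)/(47) REPRESENTATION SOCKET WITH THE LOWER ENVELOPE ON A SUB-WINDOW: «one-step trivial envelopes,
# the LOWER one on `S` ⇒ `PrintChi.TwoSidedRepOn S`» (crux `FluctuationComparisonRegPrIntL`, stmt-QuantumFields-20520, STUB 2′ `stub_laneRecordsV3` — its record's residual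
# row R3D-02; width-lever lane B «(R1) print's χ of [Balaban1985UV3] (47) back», seat ym-ust-19935-r1 g2, finding F-r1-g2-1)

WHY (F-r1-g2-1, evidence on stmt-QuantumFields-20520/19936).  Conjunct (A) `RepAtHeights` is today derived at EVERY block size from the record's one-step rows through
`LogComparisonRepAtHeights.repAtHeights_of_oneStepTriv` (p500692-lineage), whose LOWER row `T3AlphaInputsACTrivEnvelope.OneStepLowerTrivAt` asks `lowerTriv_{j+1} ≤
T_j(1_{window_j}·lowerTriv_j)` a.e. on the WHOLE sharp window of level `j+1` — the inequality that FINDING #44 (ym-ust-19201-p1, evidence #54 on stmt-QuantumFields-19201)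
shows false on the window's edge band at `L ∈ {3,5}`; print ([Balaban1985UV3] (47) p.267, p.272) carries its characteristic function `χ_k` — a window on the MINIMISER — on the
left of the lower bound and inside the fibre integral of the recursion.  The induction frame for exactly that shape is in the tree (ym-ust-19201-p1 g1,
`LogComparisonSmallFieldEnvelopeWithin.heightDensity_sandwich_within_of_oneStep`, p461482: lower envelopes on measurable sub-windows `S_j`, upper envelopes on the windows).
This file is the SOCKET over that frame, in the letters of `AlphaDataT3` and of ★r1 g0's χ-restricted representation schema `PrintChi.TwoSidedRepOn` (p528527):

* §1 `OneStepLowerTrivOn S D K j` — the lower one-step trivial envelope with the sub-window `S K (j+1)` on the LEFT and `1_{S K j}` INSIDE the transformation (print's recursion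
  shape); `TrivEnvelopeRowsOn S D b₀ p₀` (base + lower-on-`S` + upper-on-window + integrability); the sharp-window instance IS today's `TrivEnvelopeRows` (`…_window_iff`).
* §2 `heightDensity_sandwich_of_rowsOn` — per run and height: the lower trivial envelope below the restricted height density at data whose level-`(K−n)` reading lies in
  `S K (K−n)`, the upper one above it on the window.
* §3 **`twoSidedRepOn_of_oneStepTrivOn : TrivEnvelopeRowsOn S D b₀ p₀ → MainTermAtHeights D b₀ p₀ ε₀ → RmSize D C q → PrintChi.TwoSidedRepOn F γ b₀ p₀ (S read at the heights) ε₀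
  D.PintH D.EcstH D.RmH`** — conjunct (A) ON `S`; with `S :=` print's χ on the minimiser this is the consumer a print-faithful re-typing of R3D-02 needs (every interior-excision
  consumer in the tree — `PrintChi.stubBodyOn_of_repOn_of_cauchy` p529532, `InteriorExcision.bgFluctuationIntAt_of_socketOn` p539115 — reads only the On-χ representation).
* §4 sanity (`example`): at `S :=` the sharp windows the socket returns the full `RepAtHeights` (= `repAtHeights_of_oneStepTriv`, not re-declared).
Hypothesis schemas only; nothing of [Balaban1985UV3] is asserted; the measurability of the sub-windows is an explicit hypothesis.

References: T. Bałaban, CMP 102 (1985) 255–275 [Balaban1985UV3] ((1) p.256, (41) p.266, (47) p.267, (55)–(58) pp.269–270, p.272); CMP 102 (1985) 277–309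
[Balaban1985Variational] (Thm 1 (8) p.279).
-/

set_option autoImplicit false

noncomputable section

namespace Summit.QuantumFields.YangMills.Theorems.LogComparisonRepAtHeightsOn

open MeasureTheory Filter Topology
open Literature.MathematicalPhysics.QuantumFieldTheory.Balaban1983to89
open Literature.MathematicalPhysics.QuantumFieldTheory.Balaban1983to89.T3ContinuumYM3Torus
open Literature.MathematicalPhysics.QuantumFieldTheory.Balaban1983to89.T3LevelShift
open Literature.MathematicalPhysics.QuantumFieldTheory.Balaban1983to89.T3UnitLawDensityEML (ℰp measurableE_ℰp rt)
open Literature.MathematicalPhysics.QuantumFieldTheory.Balaban1983to89.T3UnitScaleTilt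
open Literature.MathematicalPhysics.QuantumFieldTheory.Balaban1983to89.T3RestrictedUnitDensity
open Literature.MathematicalPhysics.QuantumFieldTheory.Balaban1983to89.T3TiltDescent
open Literature.MathematicalPhysics.QuantumFieldTheory.Balaban1983to89.T3PrintedRegularMinimiser
open Literature.MathematicalPhysics.QuantumFieldTheory.Balaban1983to89.T3LogComparisonSocket
open Literature.MathematicalPhysics.QuantumFieldTheory.Balaban1983to89.T3AlphaInputsAC
open Literature.MathematicalPhysics.QuantumFieldTheory.Balaban1983to89.T3AlphaInputsACTrivEnvelope
open Literature.MathematicalPhysics.QuantumFieldTheory.Balaban1983to89.Missing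
open Summit.QuantumFields.YangMills.Theorems.LogComparisonSmallFieldEnvelope
open Summit.QuantumFields.YangMills.Theorems.LogComparisonSmallFieldEnvelopeWithin
open Summit.QuantumFields.YangMills.Theorems.LogComparisonRepAtHeights

/-- A family of SUB-WINDOWS of run `K`'s tower: one set of level-`j` fields per `(K, j)` (print's `{χ_j = 1}`, a window on the MINIMISER; or the sharp window itself).
[cite: Balaban1985UV3, (47) p.267] -/
abbrev LevelSets (F : T3Family) : Type :=
  (K j : ℕ) → Set (GaugeField (F.P K) j (Matrix.specialUnitaryGroup (Fin 2) ℂ))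

/-- The SHARP-WINDOW family `{W | PlaqSmall θBal(K−j) W}` (today's choice). [cite: Balaban1985UV3, (7) p.257] -/
def windowSets (F : T3Family) (γ b₀ p₀ : ℝ) : LevelSets F :=
  fun K j => {W | PlaqSmall (θBal F.L γ b₀ p₀ (K - j)) W}

/-! ## §1 The lower one-step trivial envelope on a sub-window; the rows bundled -/

section Rows

variable {F : T3Family} {γ : ℝ}

/-- **THE LOWER ONE-STEP TRIVIAL ENVELOPE OF STEP `j → j+1` OF RUN `K`, ON THE SUB-WINDOW `S`** (hypothesis schema, never asserted): a.e. on `S K (j+1)`,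
`lowerTriv_{j+1} ≤ T_j(1_{S K j}·lowerTriv_j)` — one renormalisation transformation of the (47)-minorant of level `j` RESTRICTED TO `S K j` dominates the (47)-minorant of level `j+1`
ON `S K (j+1)`.  Print's shape: (47) p.267 carries `χ_k` (the minimiser's window) on the left, p.272 «the lower bound is proved in the same way» propagates it with `χ_k` inside;
for `S :=` the sharp windows this is today's `OneStepLowerTrivAt` (`oneStepLowerTrivOn_window_iff`), which FINDING #44 refutes on the edge band at `L ∈ {3,5}`.
[cite: Balaban1985UV3, (47) p.267 and p.272] -/
def OneStepLowerTrivOn (S : LevelSets F) (D : AlphaDataT3 F γ) (K j : ℕ) (hjK : j + 1 ≤ K) : Prop :=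
  ∀ᵐ W ∂fieldMeasure (F.P K) (j + 1) (Matrix.specialUnitaryGroup (Fin 2) ℂ),
    W ∈ S K (j + 1) → lowerTriv D K (j + 1) W ≤ (rt F K j (hjK.trans (Nat.le_add_left K F.m))).T ((S K j).indicator (lowerTriv D K j)) W

/-- **THE TRIVIAL-ENVELOPE ROWS WITH THE LOWER ONE ON `S`, BUNDLED**: base (1) at every cut-off (full finest window), at every step the lower envelope ON `S` and the MASS-FREE
upper envelope on the window (unchanged), integrability. [cite: Balaban1985UV3, (1) p.256, (41) p.266, (47) p.267] -/
def TrivEnvelopeRowsOn (S : LevelSets F) (D : AlphaDataT3 F γ) (b₀ p₀ : ℝ) : Prop :=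
  (∀ K, BaseTrivAt D b₀ p₀ K) ∧
    (∀ (K j : ℕ) (hjK : j + 1 ≤ K), OneStepLowerTrivOn S D K j hjK ∧ OneStepUpperTrivAt D b₀ p₀ K j hjK) ∧
      TrivExpIntegrable D

variable {D : AlphaDataT3 F γ} {b₀ p₀ : ℝ}

/-- At the sharp windows the lower row on `S` IS today's full-window lower row (definitional). [cite: Balaban1985UV3, (47) p.267] -/
theorem oneStepLowerTrivOn_window_iff (K j : ℕ) (hjK : j + 1 ≤ K) :
    OneStepLowerTrivOn (windowSets F γ b₀ p₀) D K j hjK ↔ OneStepLowerTrivAt D b₀ p₀ K j hjK :=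
  Iff.rfl

/-- At the sharp windows the bundled rows on `S` ARE today's `TrivEnvelopeRows` (definitional). [cite: Balaban1985UV3, (41) p.266 and (47) p.267] -/
theorem trivEnvelopeRowsOn_window_iff :
    TrivEnvelopeRowsOn (windowSets F γ b₀ p₀) D b₀ p₀ ↔ TrivEnvelopeRows D b₀ p₀ :=
  Iff.rfl

end Rows

/-! ## §2 The sandwich at the heights: lower envelope on `S`, upper envelope on the window -/

section Sandwich

variable {F : T3Family} {γ : ℝ} {S : LevelSets F} {D : AlphaDataT3 F γ} {b₀ p₀ : ℝ}

/-- **THE ENVELOPE AT THE HEIGHTS FROM THE ROWS ON `S`** (per run, per height): for `n ≤ K`, measurable sub-windows `S K j ⊆ {PlaqSmall θBal(K−j)}` and the rows `TrivEnvelopeRowsOn S`,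
a.e. on the comparison lattice: if the level-`(K−n)` reading of `V` lies in `S K (K−n)` then `lowerTriv_{K−n} ≤` run `K`'s restricted height density on `histGood K n` at `V`, and on the
window the density is `≤ upperTriv_{K−n}` — the within-frame `heightDensity_sandwich_within_of_oneStep` (ym-ust-19201-p1) at `ℓ_j := lowerTriv D K j`, `u_j := upperTriv D K j`,
`θ := θBal`. [cite: Balaban1985UV3, (41) p.266 and (47) p.267] -/
theorem heightDensity_sandwich_of_rowsOn (hγ : 0 ≤ γ) (hSm : ∀ K j, MeasurableSet (S K j))
    (hSsub : ∀ K j, j ≤ K → S K j ⊆ {W | PlaqSmall (θBal F.L γ b₀ p₀ (K - j)) W})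
    (hrows : TrivEnvelopeRowsOn S D b₀ p₀) {K n : ℕ} (hK : n ≤ K) :
    ∀ᵐ V ∂fieldMeasure (F.P n) 0 (Matrix.specialUnitaryGroup (Fin 2) ℂ),
      (fieldShift (F.sitesPerDir_eq (m := F.m) (K := K) (j := K - n) (m' := F.m) (K' := n) (j' := 0) (by omega)) V ∈ S K (K - n) →
        lowerTriv D K (K - n) (fieldShift (F.sitesPerDir_eq (m := F.m) (K := K) (j := K - n) (m' := F.m) (K' := n) (j' := 0) (by omega)) V) ≤
          heightDensity F γ hK (histGood F ℰp (θBal F.L γ b₀ p₀) K n) V) ∧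
      (PlaqSmall (θBal F.L γ b₀ p₀ n) V → heightDensity F γ hK (histGood F ℰp (θBal F.L γ b₀ p₀) K n) V ≤
          upperTriv D K (K - n) (fieldShift (F.sitesPerDir_eq (m := F.m) (K := K) (j := K - n) (m' := F.m) (K' := n) (j' := 0) (by omega)) V)) := by
  refine heightDensity_sandwich_within_of_oneStep F hγ K (θBal F.L γ b₀ p₀) (S K) (fun j => lowerTriv D K j) (fun j => upperTriv D K j) hK
    (hSm K) (fun j hj => hSsub K j (by omega))
    (fun j hj => integrable_lowerTriv hrows.2.2 (by omega)) (fun j hj => integrable_upperTriv hrows.2.2 (by omega)) ?_ ?_ ?_ ?_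
  · filter_upwards [hrows.1 K] with W hW hWS
    exact (hW (hSsub K 0 (Nat.zero_le K) hWS)).1
  · filter_upwards [hrows.1 K] with W hW hWs
    exact (hW hWs).2
  · intro j hj
    exact (hrows.2.1 K j (by omega)).1
  · intro j hj
    exact (hrows.2.1 K j (by omega)).2

end Sandwich

/-! ## §3 The socket theorem: envelopes with the lower one on `S` ⇒ `PrintChi.TwoSidedRepOn S` -/

section Socket

variable {F : T3Family} {γ : ℝ} {S : LevelSets F} {D : AlphaDataT3 F γ} {b₀ p₀ ε₀ C q : ℝ}

/-- The sub-window family read at the heights: the predicate `PrintChi.TwoSidedRepOn` quantifies over (the level-`(K−n)` reading of the height-`n` datum lies in `S K (K−n)`).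
[cite: Balaban1985UV3, (47) p.267] -/
def atHeights (S : LevelSets F) :
    (K n : ℕ) → n ≤ K → GaugeField (F.P n) 0 (Matrix.specialUnitaryGroup (Fin 2) ℂ) → Prop :=
  fun K n h V => fieldShift (F.sitesPerDir_eq (m := F.m) (K := K) (j := K - n) (m' := F.m) (K' := n) (j' := 0)
    ((Nat.add_assoc F.m n (K - n)).trans (congrArg (HAdd.hAdd F.m) (Nat.add_sub_cancel' h))).symm) V ∈ S K (K - n)

/-- **SOCKET THEOREM — CONJUNCT (A) ON A SUB-WINDOW FROM NAMED ROWS**: if a datum `D : AlphaDataT3 F γ` carries the trivial-envelope rows at the profile `(b₀, p₀)` with the LOWER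
one-step envelope asked only ON measurable sub-windows `S K j ⊆ {PlaqSmall θBal(K−j)}` (`TrivEnvelopeRowsOn S`: base (1), lower (47) on `S` with `1_S` inside, MASS-FREE upper
(55)·(58) on the windows, integrability), its trivial-history main term at the heights is print's background action (`MainTermAtHeights`, (42) + [Balaban1985Variational] Thm 1) and its
remainders have the printed size (`RmSize`), THEN `PrintChi.TwoSidedRepOn F γ b₀ p₀ (atHeights S) ε₀ D.PintH D.EcstH D.RmH` — [Balaban1985UV3] (41) ∧ (47) at the trivial history for the
RESTRICTED height densities, two-sided with slack `Rm` (`≥ 0`, summable along every free fraction), asserted at the data of the window whose reading lies in `S`.  The On-`S` twin of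
`LogComparisonRepAtHeights.repAtHeights_of_oneStepTriv`; with `S :=` print's χ on the minimiser it is the consumer of a print-faithful residual row R3D-02.
[cite: Balaban1985UV3, (41) p.266 and (47) p.267; Balaban1985Variational, Thm 1 (8) p.279] -/
theorem twoSidedRepOn_of_oneStepTrivOn (hγ : 0 ≤ γ) (hSm : ∀ K j, MeasurableSet (S K j))
    (hSsub : ∀ K j, j ≤ K → S K j ⊆ {W | PlaqSmall (θBal F.L γ b₀ p₀ (K - j)) W})
    (hrows : TrivEnvelopeRowsOn S D b₀ p₀) (hmain : MainTermAtHeights D b₀ p₀ ε₀) (hRm : RmSize D C q) :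
    PrintChi.TwoSidedRepOn F γ b₀ p₀ (atHeights S) ε₀ D.PintH D.EcstH D.RmH := by
  refine ⟨rmH_nonneg hRm, summable_rmH hRm, fun K n h => ?_⟩
  filter_upwards [heightDensity_sandwich_of_rowsOn hγ hSm hSsub hrows h] with V hV hs hS _
  obtain ⟨hlow, hup⟩ := hV
  have h1 := hlow hS
  have h2 := hup hs
  rw [lowerTriv_eq_exp] at h1
  rw [upperTriv_eq_exp] at h2
  obtain ⟨-, hlog⟩ := pos_and_abs_log_sub_le_of_exp_sandwich h1 h2
  rw [hmain K n h V hs] at hlog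
  have e : Real.log (heightDensity F γ h (histGood F ℰp (θBal F.L γ b₀ p₀) K n) V) +
        (F.scheme ℰp γ).β K * minActionRegPr F n K h ε₀ V - D.PintH K n V + D.EcstH K n =
      Real.log (heightDensity F γ h (histGood F ℰp (θBal F.L γ b₀ p₀) K n) V) -
        (-((F.scheme ℰp γ).β K * minActionRegPr F n K h ε₀ V) +
          D.Pint K (K - n) (D.triv K (K - n))
            (fieldShift (F.sitesPerDir_eq (m := F.m) (K := K) (j := K - n) (m' := F.m) (K' := n) (j' := 0) (by omega)) V) -
          D.Ecst K (K - n)) := by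
    rw [D.PintH_of_le h]
    unfold AlphaDataT3.PintTriv AlphaDataT3.EcstH
    ring
  show _ ≤ D.Rm K (K - n)
  rw [e]
  exact hlog

/-! ## §4 Sanity: at the sharp windows the socket returns the full representation -/

/-- The window family read at the heights is implied by the window guard of the socket (so `TwoSidedRepOn (atHeights window)` is the full `TwoSidedRepAt`). [cite: Balaban1985UV3, (7) p.257] -/
theorem atHeights_window_of_plaqSmall {K n : ℕ} (h : n ≤ K) {V : GaugeField (F.P n) 0 (Matrix.specialUnitaryGroup (Fin 2) ℂ)}
    (hs : PlaqSmall (θBal F.L γ b₀ p₀ n) V) : atHeights (windowSets F γ b₀ p₀) K n h V := by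
  show PlaqSmall (θBal F.L γ b₀ p₀ (K - (K - n))) (fieldShift _ V)
  rw [show K - (K - n) = n by omega]
  exact (T3CruxEstimates.plaqSmall_fieldShift F _ _ V).mpr hs

/-- **AT THE SHARP WINDOWS THE SOCKET IS TODAY'S** (sanity `example`, no new declaration: the statement IS `LogComparisonRepAtHeights.repAtHeights_of_oneStepTriv`, recovered
through `twoSidedRepOn_of_oneStepTrivOn` at `S :=` the sharp windows, measurable by `T3UnitScaleTilt.measurableSet_plaqSmall`). [cite: Balaban1985UV3, (41) p.266 and (47) p.267] -/
example (hγ : 0 ≤ γ) (hrows : TrivEnvelopeRows D b₀ p₀) (hmain : MainTermAtHeights D b₀ p₀ ε₀) (hRm : RmSize D C q) : RepAtHeights D b₀ p₀ ε₀ := by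
  have hOn := twoSidedRepOn_of_oneStepTrivOn (S := windowSets F γ b₀ p₀) hγ (fun K j => measurableSet_plaqSmall _)
    (fun K j _ => subset_rfl) (trivEnvelopeRowsOn_window_iff.2 hrows) hmain hRm
  obtain ⟨h0, hsum, hae⟩ := hOn
  refine ⟨h0, hsum, fun K n h => ?_⟩
  filter_upwards [hae K n h] with V hV hs hpos
  exact hV hs (atHeights_window_of_plaqSmall h hs) hpos

end Socket

end Summit.QuantumFields.YangMills.Theorems.LogComparisonRepAtHeightsOn

end
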